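import Literature.NumberTheory.EllipticCurves.Kobayashi2003.SignedColemanKatoZeta
import Literature.NumberTheory.EllipticCurves.GlobalMinimalModel
import Literature.NumberTheory.EllipticCurves.PAdicHeights
import Literature.NumberTheory.EllipticCurves.Kato2004.Condition1252
import HarnessLib

/-!
# Fouquet–Wan (arXiv:2107.13726, PREPRINT), Thm. 4.51 = Thm. 1.13 (the CRYSTALLINE chain of §4.6) WITH the
# SL₂(ℤ_p)-image hypothesis its proof invokes, for an elliptic curve at a good supersingular odd prime with
# `a_p = 0`: the CLAIMED Kato main conjecture read on the pinned objects of Kobayashi's `η = 1` Coleman/Kato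
# package — the weaker, AUDITED companion of `thm51_katoMainIdentity_OPEN` (nothing asserted; NEVER a theorem)

Topic `NumberTheory/EllipticCurves`, sub-directory `FouquetWan2021` (namespace = path). HONEST FRAMING: an
UNREFEREED preprint enters the tree only as an explicitly labelled OPEN hypothesis (`[claim: …, status:
under-review]`), NEVER as a theorem and never as a named fact with `_holds`; nothing here is asserted about
any curve; nothing is booked; BSD is not proved by any of this. Fourth file of this directory; companion of
`thm51_katoMainIdentity_OPEN` (Thm. 5.1 read on the package, same frame and conclusion): THIS file reads the
preprint's OTHER route to the same conclusion — Thm. 4.51 (§4.6: U(3,1) Eisenstein side Thm 4.41/7.32 ⇒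
Beilinson–Flach Prop 4.42 ⇒ powers of `p` §4.6.3), the chain the cell `bsd-ssimc` actually audited (W-lev-9,
MEMO-5), whose §4.6.3 INVOKES Kato's integral divisibility and hence Kato's (12.5.2) `Kato2004.ImageContainsSL2 W p`
(a hypothesis the printed statement of 4.51 omits; carried here, exactly as in the accepted composite
`FouquetWan2021_thm451_via_kobayashi74_OPEN`) — where the tree now has a home for «Kato's main conjecture for `E`
at `p`» itself — the pinned objects of the ACCEPTED `η = 1` package
`Kobayashi2003.SignedColemanKatoData` / `thm62_63_73_signedColemanKato_zeta` — EXACTLY as the published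
`Kim2026.thm111_katoMainIdentity_of_kuriharaNumber_ne_zero` and the preprint
`CastellaSano2026.thm1_katoMainIdentity_of_kimTamagawaDefect_OPEN` read their Kato-IMC conclusions (same
frame, same conclusion shape). Purpose: the accepted COMPOSITE binder `FouquetWan2021_thm451_via_kobayashi74_OPEN`
(`Summits/BirchSwinnertonDyer/Rank1Residual/Supersingular/KobayashiMainConjectureX7FouquetWanCrystalline.lean`: «FW
Thm 4.51 (PRE, §4.6 only) ∘ Kobayashi Thm 7.4 (PUB)», ± currency; 9 consumer files) becomes DERIVABLE from this
binder with Kobayashi's Thm. 7.4 run in the kernel (consumer, Summits-side: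
`Theorems/SignedLowerHalvesKobayashiLowerHalfLargeImageKuriharaRigidityFouquetWanCrystallineKatoFrame.lean`; cell
`bsd-ssimc`, seat `bsd-line-slh-p1-w2` g2), as the sibling does for the §5 composite.

## Sources, verbatim (held texts; page = chunk file number)

O. Fouquet, X. Wan, *The Iwasawa Main Conjecture for universal families of modular motives*,
arXiv:2107.13726 (2021) [FouquetWan2021] (held `paper:arxiv-2107.13726`; FRESHNESS 2026-08-28: arXiv only).
p0002: "Let `p > 2` be a prime. Let `ℚ_∞/ℚ` be the cyclotomic `ℤ_p`-extension of `ℚ`, let `Γ_Iw` be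
`Gal(ℚ_∞/ℚ)` and let `Λ_Iw := ℤ_p[[Γ_Iw]]`." p0004, **Conjecture 1.5 ([KatoEuler] Conjecture 12.10)** (=
(ConjIMC)): "Let `z(f)_Iw ∈ Δ(M(f))_Iw ⊗_{Λ_Iw} Frac(Λ_Iw)` be the basis of theorem 1.4. Then `z(f)_Iw` is a
basis of `Δ(M(f))_Iw`. Equivalently, there is an equality of characteristic ideals
`char_{Λ_Iw} H²_et(ℤ[1/p], T ⊗ Λ_Iw) = char_{Λ_Iw} H¹_et(ℤ[1/p], T ⊗ Λ_Iw)/Λ_Iw·z(f)_Iw`." p0053, **Theorem 5.1.**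
"Let `p ≥ 3` be a prime. Let `f ∈ S_k(Γ₀(Np^r))` be a normalized eigencuspform with `k ≥ 2`. Assume that
`ρ̄_f` satisfies the following properties. • The `G_{ℚ,Σ}`-representation `ρ̄_f` is absolutely irreducible.
• The semisimplification of `ρ̄_f|G_{ℚ_p}` is not equal to `χ̄ ⊕ χ̄_cyc χ̄`. • There exists `ℓ ∤ p` such that
`ρ̄_f|G_{ℚ_ℓ}` is a ramified extension `0 → μχ_cyc^{1−k/2} → ρ̄|G_{ℚ_ℓ} → μχ_cyc^{−k/2} → 0` where
`μ : G_{ℚ_ℓ} → {±1}` is an unramified character. If moreover `ρ̄_f|G_{ℚ_p}` is irreducible, then `μ` is not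
trivial. If `ℓ ∥ N`, then the zeta morphism is an isomorphism `triv_{z(f)_Iw} : Δ_{O_Iw}(T(f)_Iw) ≅ O_Iw`.
Equivalently, conjecture (ConjIMC) is true." p0050 L20–L40, **Theorem 4.51** (= Thm. 1.13; §4.6 "the Iwasawa
Main Conjecture in the crystalline case"), as transcribed in the composite's docstring: `f ∈ S_k(Γ₀(N))` normalised,
`k ≥ 2`; (i) `ρ_f|G_{ℚ_p}` crystalline and short; (ii) `ρ̄_f|G_{ℚ_p}` absolutely irreducible; (iii) `∃ ℓ ∥ N`,
`dim ρ̄^{I_ℓ} = 1`, `dim ρ̄^{G_ℓ} = 0` ⟹ Kato's main conjecture for `M(f)`; §4.6.3 (p0046) opens "as we already know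
that `char H²_ét(ℤ[1/p], T(f)_Iw)` divides `char H¹_ét/Λ·z(f)_Iw`", i.e. it uses Kato's INTEGRAL divisibility, stated
(Thm (TheoKatoIntro), p0004 L1) under "the image of `ρ_f|G_{ℚ(ζ_{p^∞})}` contains a subgroup conjugated to `SL₂(ℤ_p)`".
S. Kobayashi, Invent. Math. 152 (2003) [Kobayashi2003], p. 10 (§5): "In [6], Kato formulated the Iwasawa main
conjecture for motives. As a special case, his main conjecture can be read as follows (cf. Conjecture 12.10 in
[7]). **Conjecture (Kato's main conjecture).** `Char 𝐇²(T) = Char 𝐇¹(T)/Z(T)`." Prop. 7.1 ii) (p. 12):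
"`𝐇²(T)` is isomorphic to `X⁰(E/K_∞)` as `Λ`-module." K. Kato, Astérisque 295 (2004) [Kato2004Asterisque],
Thm. 12.6 (p. 222): the `Λ`-submodule `Z ⊂ Z(f,T)` generated by the integral zeta elements, "`Z(f,T)/Z` is a
finite group"; Conj. 12.10 (p. 224).

## Transcription for an ELLIPTIC CURVE at a GOOD SUPERSINGULAR odd prime (weaker than print; flags)

`A = E`, `f = f_E` of weight `2`, trivial character, level `N = N_E` with `p ∤ N`: transcribed EXACTLY as in the
accepted composite binder `FouquetWan2021_thm451_via_kobayashi74_OPEN` — the `thm51` companion's hypotheses PLUS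
Kato's (12.5.2) `Kato2004.ImageContainsSL2 W p` (discharged on X7 ∧ Surj by the tree theorem
`ClassX7.imageContainsSL2_of_surj` at every odd `p`): `p ≠ 2`; `W.HasGoodReductionAtPrime p` with `a_p = 0` (then
`ρ̄|G_{ℚ_p}` is irreducible — height-`2` formal group — so the second bullet holds and `μ` must be NON-trivial);
"`ρ̄_f` absolutely irreducible" = `W.HasIrreducibleModPGaloisRep p` (irreducible and odd, `p` odd); the third
bullet at `ℓ ≠ p` for `k = 2` = `E` has multiplicative reduction at `ℓ` (the Tate-curve extension), `μ(Frob_ℓ) =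
a_ℓ = −1` (NON-SPLIT), and the extension is RAMIFIED, i.e. `E[p]` ramified at `ℓ`, i.e. `p ∤ ord_ℓ(Δ_min)`;
`ℓ ∥ N` is automatic at a multiplicative prime ((iii) in FW's convention `ρ_f = T_pE(−1)`: sub-character the
unramified `μ`, `μ ≠ 1`); (i) crystalline = good at `p`, short since `k = 2 ≤ p`. FRAME = that of the package fact and of the Kim / Castella–Sano
companions: structure facts of `T_pW` as instance BINDERS, a newform `f` of `W` (any level), the period ratio `ϖ`
(`ϖ·Ω(W) = Ω⁺_f`; a parameter of the package only — FW's hypotheses are on `ρ̄`, no period or Manin input), the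
cyclotomic `κ` with generator `γ` matching the cyclotomic variable. CONCLUSION, (ConjIMC) for `M(f_E)` = Kato's
Conj. 12.10 `Char 𝐇²(T) = Char 𝐇¹(T)/Z(f,T)`, READ ON THE PACKAGE as in the companions: for every sign `ε` and
all pinned `I : Kato2004.IwasawaH1Data W p κ γ` (`𝐇¹(T)^Δ`), `Y : W.FineSelmerDualData κ γ` (`X⁰(E/K_∞)^Δ ≅
𝐇²(T)^Δ`, Prop. 7.1 ii)) there is a package datum `d : Kobayashi2003.SignedColemanKatoData W p f ϖ κ γ ε I` with
`Module.charIdeal Λ Y.X = Module.charIdeal Λ (I.H ⧸ d.Z)`. READING FLAGS: `FW21-451-eta1-zeta-line` (= the companion's `FW21-51-eta1-zeta-line`: (FW's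
`Λ_Iw·z(f)_Iw`, the optimally normalised basis of Kato's Thm. 12.4/12.5, vs the package's `d.Z` = Kato's Thm.
12.6 submodule, of finite index in `Z(f,T) = Z(T)` (Kato Thm. 12.6, Kobayashi Thm. 5.2 iv)) — characteristic
ideals do not see finite index; FW state the equivalence of their formulation with Kato's Conj. 12.10
themselves (Conj. 1.5); `H²_et(ℤ[1/p], T ⊗ Λ_Iw)` vs `𝐇²(T)^Δ ≅ X⁰(E/K_∞)^Δ` = Kato's §12.2/§13.8 reading already
carried by `Kato2004/IwasawaCohomology.lean` and `KatoFineSelmerDual.lean`); `FW21-451-package` (existential `d`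
bundling the PUBLISHED package construction, as in the companions); `A-KATO-3` (inherited verbatim from the
composite binder's docstring: "at `p = 3` the integral Kato input wants the SL₂(ℤ₃)-image" — FW Thm. 5.1 is
printed for `p ≥ 3` under absolute irreducibility of `ρ̄_f`; the integrality `Z(T) ⊆ 𝐇¹(T)` at a supersingular
`p` is Kobayashi Thm. 5.2 iv) / Remark 5.3 i), any odd `p`; the flag records that the cell's audit MEMO-5 of the
preprint's §4–§5 located no statement-level obstruction but did not re-derive the `p = 3` Euler-system input);
`FW21-Wan15` (the preprint's non-ordinary Eisenstein side imports Wan 2015, superseded / re-pointable to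
Castella–Liu–Wan FMS 2022 per the composite's docstring and the cell's audit). NEVER cite this `Prop` as a
theorem; take it as an explicit hypothesis `(hFW : …)`.
-- TODO(general form): FW's Thm. 4.51 allows any weight `k ≥ 2` with `ρ_f|G_{ℚ_p}` crystalline and short and
-- coefficients `O`; only the good supersingular `a_p = 0` elliptic-curve case on the `η = 1` package is typed.

What this binder is NOT: not the signed main conjecture (derived Summits-side by the kernel Thm. 7.4 at every
odd `p`); not Thm. 5.1 (the companion `thm51_katoMainIdentity_OPEN`, which implies this one by dropping the image
hypothesis); not Cor. 5.3 / 5.4, not the `η`-component reading (siblings); not a claim at split multiplicative `ℓ`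
or at a `ℓ` with `p ∣ ord_ℓ(Δ_min)` or without (12.5.2).

## References

* O. Fouquet, X. Wan, arXiv:2107.13726 (2021): Conj. 1.5 and Thm (TheoKatoIntro) (PDF p. 4), Thm. 4.41, Prop.
  4.42, §4.6.3 (PDF p. 46), Thm. 4.51 (PDF p. 50), Thm. 5.1 (PDF p. 53). [FouquetWan2021]
* K. Kato, Astérisque 295 (2004): (12.5.2) in Thm. 12.5 (4) (p. 222). [Kato2004Asterisque]
* S. Kobayashi, Invent. Math. 152 (2003): §5 (p. 10), Thm. 5.2 iv), Remark 5.3 i), Prop. 7.1 ii) (p. 12),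
  Thm. 7.3 i), Thm. 7.4 (p. 13). [Kobayashi2003]
* K. Kato, Astérisque 295 (2004): §12.2, Thm. 12.4–12.6 (pp. 221–222), Conj. 12.10 (p. 224). [Kato2004Asterisque]
-/

noncomputable section

open scoped Classical MatrixGroups ModularForm

open CongruenceSubgroup WeierstrassCurve Field Literature.NumberTheory.EllipticCurves
  Literature.NumberTheory.EllipticCurves.ModularForms Literature.NumberTheory.GaloisRepresentations

namespace Literature.NumberTheory.EllipticCurves.FouquetWan2021

/-- **OPEN HYPOTHESIS — UNREFEREED PREPRINT (Fouquet–Wan, arXiv:2107.13726, 2021), Thm. 4.51 = Thm. 1.13 (§4.6,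
the crystalline chain) WITH the SL₂(ℤ_p)-image hypothesis its proof invokes, for `f = f_E` at a good supersingular
odd prime with `a_p = 0`, Kato's main identity [C] read on Kobayashi's `η = 1` Coleman/Kato package.** Source
(PDF p. 50, as transcribed in the accepted composite `FouquetWan2021_thm451_via_kobayashi74_OPEN`): (i) `ρ_f|G_{ℚ_p}`
crystalline and short; (ii) `ρ̄_f|G_{ℚ_p}` absolutely irreducible; (iii) `∃ ℓ ∥ N`, `dim ρ̄^{I_ℓ} = 1`,
`dim ρ̄^{G_ℓ} = 0` ⟹ Kato's main identity [C] (their 1.5 = Kato's 12.10) for `M(f)`; the §4.6.3 proof uses Kato's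
INTEGRAL divisibility, stated (p. 4) under «the image of `ρ_f|G_{ℚ(ζ_{p^∞})}` contains `SL₂(ℤ_p)`». TRANSCRIBED
(elliptic curve, `k = 2`): `W/ℚ` globally minimal, `p ≠ 2` GOOD with `a_p = 0` (crystalline, short; `ρ̄|G_{ℚ_p}`
irreducible), `E[p]` irreducible, Kato's (12.5.2) `Kato2004.ImageContainsSL2 W p`, a prime `ℓ ≠ p` of NON-SPLIT
multiplicative reduction with `E[p]` RAMIFIED at `ℓ` (`p ∤ ord_ℓ Δ_min`); frame of the `η = 1` package (newform `f`
of `W`, period ratio `ϖ`, cyclotomic `(κ, γ)` matching the variable); CONCLUSION read on the package: for every sign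
`ε`, all pinned `I : Kato2004.IwasawaH1Data W p κ γ`, `Y : W.FineSelmerDualData κ γ`, some package datum `d` has
`Module.charIdeal Λ Y.X = Module.charIdeal Λ (I.H ⧸ d.Z)` (readings `FW21-451-eta1-zeta-line`, `FW21-451-package`,
`A-KATO-3`, `FW21-Wan15`; module docstring). Implied by the companion `thm51_katoMainIdentity_OPEN`. NEVER cite this
`Prop` as a theorem (FRESHNESS 2026-08-28: arXiv only); take it as an explicit hypothesis. Nothing asserted.
[claim: FouquetWan2021, status: under-review]
[cite: Kobayashi2003, §5 (p. 10), Prop. 7.1 ii) (p. 12), Thm. 5.2 iv) and Remark 5.3 i) (pp. 9–10)]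
[cite: Kato2004Asterisque, (12.5.2) in Thm. 12.5 (4) and Thm. 12.6 (p. 222), Conj. 12.10 (p. 224)] -/
def thm451_katoMainIdentity_OPEN : Prop :=
  ∀ (W : WeierstrassCurve ℚ) [W.IsElliptic] [W.IsGloballyMinimal] (p : ℕ) [Fact p.Prime]
    [ContinuousSMul ℤ_[p] (W.tateModule p)] [Module.Free ℤ_[p] (W.tateModule p)]
    [Module.Finite ℤ_[p] (W.tateModule p)]
    {N : ℕ} [NeZero N] (f : CuspForm (Gamma0 N) 2) (ϖ : ℚ)
    (κ : ZpExtension ℚ p) (γ : absoluteGaloisGroup ℚ),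
  -- the frame of Kobayashi's `η = 1` package, at an odd good prime with `a_p = 0`
    p ≠ 2 → W.HasGoodReductionAtPrime p → W.frobeniusTrace p = 0 → IsNewformOf W f →
    (ϖ : ℝ) * W.realPeriodRat = plusPeriod f →
    κ.IsCyclotomic → κ.IsTopGenerator γ → IsCyclotomicVariable p γ →
  -- Fouquet–Wan's hypotheses: `ρ̄` absolutely irreducible; Kato's (12.5.2); a ramified NON-SPLIT Steinberg `ℓ ≠ p`
    W.HasIrreducibleModPGaloisRep p → Kato2004.ImageContainsSL2 W p →
    (∃ (ℓ : ℕ) (_ : Fact ℓ.Prime), ℓ ≠ p ∧ W.HasMultiplicativeReductionAtPrime ℓ ∧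
        ¬ W.HasSplitMultiplicativeReductionAtPrime ℓ ∧ ¬ p ∣ padicValInt ℓ W.minimalDiscriminantInt) →
  -- (ConjIMC): Kato's main identity, read on the pinned objects through the `η = 1` package
  ∀ (ε : ℤˣ) (I : Kato2004.IwasawaH1Data W p κ γ) (Y : W.FineSelmerDualData κ γ),
    ∃ d : Kobayashi2003.SignedColemanKatoData W p f ϖ κ γ ε I,
      Module.charIdeal (IwasawaAlgebra p) Y.X =
        Module.charIdeal (IwasawaAlgebra p) (I.H ⧸ d.Z)

end Literature.NumberTheory.EllipticCurves.FouquetWan2021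

end
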